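import Mathlib.RingTheory.Polynomial.Pochhammer
import Literature.NumberTheory.Automorphic.JordanDecompositionAlgGroup
import HarnessLib

/-!
# The binomial one-parameter subgroup `t ↦ xᵗ` of a unipotent matrix in characteristic zero
(trunk T-AUTOMORPHIC, G25 AutomorphicL; Springer 2.4, 3.4, used for 6.3.5)

Companion to `LinearAlgebraicGroups.lean` / `JordanDecompositionAlgGroup.lean` (namespace
`Literature.Automorphic`; `IsUnipotentElt`, `IsAlgebraicSubgroup`, `IsAlgebraicAddHom`). Over a field
`k` of characteristic `0`, a unipotent matrix `x = 1 + N` (`N` nilpotent) lies in a canonical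
one-parameter subgroup: `xᵗ = ∑ⱼ (t choose j) Nʲ` (`unipotentBinom x t`; the series is a finite
sum, the binomial coefficient is the polynomial `t (t-1) ⋯ (t-j+1) / j!`). All proved:

* `unipotentBinom_natCast` — `xʲ = unipotentBinom x j` for `j ∈ ℕ` (the binomial theorem);
* `unipotentBinom_add` — **`x^{a+b} = xᵃ xᵇ`** for all `a, b ∈ k`: the entries of both sides
  are polynomials in `(a, b)` agreeing on `ℕ × ℕ`, hence everywhere (characteristic `0`);
  `unipotentBinomHom x : 𝔾ₐ → GL n k` is the resulting homomorphism, an algebraic one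
  (`isAlgebraicAddHom_unipotentBinomHom`) with `unipotentBinomHom x 1 = x`;
* `unipotentBinomHom_mem` — **`xᵗ` lies in every algebraic subgroup containing `x`**
  (a polynomial in `t` vanishing on `ℕ` vanishes), i.e. in the Zariski closure of `⟨x⟩`;
* `exists_pow_eq_of_isUnipotentElt` — consequently **unipotent elements have `M`-th roots inside
  any algebraic subgroup containing them** (`y = x^{1/M}`), the divisibility of unipotent groups
  in characteristic `0` used for the conjugacy theorems of Springer 6.3.5
  (`SolvableGroupTori.lean`); the roots are unipotent and are polynomials in `x - 1` without
  constant term (`unipotentBinom_sub_one`).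

Springer treats `𝔾ₐ`-structure of unipotent groups in 3.4 (in characteristic `0` a unipotent
group is a vector group via `exp`/`log`); the present binomial form avoids `log` and is exactly
what 6.3.5 needs. In characteristic `p` the analogue is that unipotent elements have `p`-power
order (`FlagLoweringSubgroups.pow_char_mem_flagLoweringSubgroup_succ`).

## Mathlib

`descPochhammer`, `descPochhammer_eval_eq_descFactorial`, `Nat.descFactorial_eq_factorial_mul_choose`,
`Commute.add_pow`, `Polynomial.eq_zero_of_infinite_isRoot`, `RingHom.map_det`; nilpotent
matrices (`pow_card_eq_zero_of_isNilpotent` of `JordanDecompositionAlgGroup.lean`). Mathlib has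
`IsNilpotent.exp` (`Mathlib.RingTheory.Nilpotent.Exp`) but no logarithm / one-parameter subgroup
through a given unipotent (searched `unipotent`, `one_parameter`, `Nilpotent.log`).

## References

* T. A. Springer, *Linear Algebraic Groups*, 2nd ed., Progress in Mathematics 9, Birkhäuser
  (1998), 2.4.5, 3.4, 6.3.5.
-/

open scoped MatrixGroups

namespace Literature.NumberTheory.Automorphic

open Polynomial
open scoped Matrix

variable {k : Type*} [Field k] {n : Type*} [Fintype n] [DecidableEq n]

/-! ### Binomial coefficient polynomials -/

section Binom

/-- The binomial coefficient as a polynomial in the upper argument: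
`choosePoly j = X (X - 1) ⋯ (X - j + 1) / j!`. [folklore] -/
noncomputable def choosePoly (k : Type*) [Field k] (j : ℕ) : k[X] :=
  C ((j.factorial : k)⁻¹) * descPochhammer k j

/-- At natural numbers `choosePoly j` is the binomial coefficient (characteristic `0`).
[folklore] -/
theorem eval_natCast_choosePoly [CharZero k] (m j : ℕ) :
    (choosePoly k j).eval (m : k) = (m.choose j : k) := by
  rw [choosePoly, eval_mul, eval_C, descPochhammer_eval_eq_descFactorial,
    Nat.descFactorial_eq_factorial_mul_choose, Nat.cast_mul, ← mul_assoc,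
    inv_mul_cancel₀ (Nat.cast_ne_zero.2 (Nat.factorial_ne_zero j)), one_mul]

/-- `choosePoly 0 = 1`. [folklore] -/
@[simp] theorem choosePoly_zero : choosePoly k 0 = 1 := by
  simp [choosePoly]

variable [CharZero k]

/-- A polynomial over a field of characteristic zero vanishing on `ℕ` is zero. [folklore] -/
theorem Polynomial.eq_zero_of_forall_eval_natCast_eq_zero {p : k[X]}
    (h : ∀ m : ℕ, p.eval (m : k) = 0) : p = 0 := by
  refine p.eq_zero_of_infinite_isRoot (Set.Infinite.mono ?_
    (Set.infinite_range_of_injective (Nat.cast_injective (R := k))))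
  rintro _ ⟨m, rfl⟩
  exact h m

/-- Two polynomials over a field of characteristic zero agreeing on `ℕ` are equal. [folklore] -/
theorem Polynomial.eq_of_forall_eval_natCast_eq {p q : k[X]}
    (h : ∀ m : ℕ, p.eval (m : k) = q.eval (m : k)) : p = q := by
  rw [← sub_eq_zero]
  exact Polynomial.eq_zero_of_forall_eval_natCast_eq_zero fun m => by rw [eval_sub, h m, sub_self]

end Binom

/-! ### The binomial series `xᵗ = ∑ (t choose j) (x - 1)ʲ` -/

section Series

/-- **The binomial one-parameter family through a unipotent matrix**:
`unipotentBinom x t = ∑_{j < n} (t choose j) (x - 1)ʲ` ("`xᵗ`"; a finite sum since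
`(x - 1)ⁿ = 0` for `x` unipotent). [folklore] -/
noncomputable def unipotentBinom (x : Matrix n n k) (t : k) : Matrix n n k :=
  ∑ j ∈ Finset.range (Fintype.card n), (choosePoly k j).eval t • (x - 1) ^ j

/-- The entries of `unipotentBinom x t` are polynomials in `t`:
`(xᵗ) a b = (∑ⱼ choosePoly j · ((x-1)ʲ) a b) (t)`. [folklore] -/
noncomputable def unipotentBinomEntryPoly (x : Matrix n n k) (a b : n) : k[X] :=
  ∑ j ∈ Finset.range (Fintype.card n), choosePoly k j * C (((x - 1) ^ j) a b)

/-- The entries of `xᵗ` are the values of `unipotentBinomEntryPoly`. [folklore] -/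
theorem unipotentBinom_apply (x : Matrix n n k) (t : k) (a b : n) :
    unipotentBinom x t a b = (unipotentBinomEntryPoly x a b).eval t := by
  simp only [unipotentBinom, unipotentBinomEntryPoly, Matrix.sum_apply, Matrix.smul_apply,
    smul_eq_mul, eval_finsetSum, eval_mul, eval_C]

/-- `xᵗ - 1` is `(x - 1)` times a polynomial in `x - 1`: explicitly
`xᵗ - 1 = (x - 1) ∑_{1 ≤ j < n} (t choose j) (x-1)^{j-1}`. [folklore] -/
theorem unipotentBinom_sub_one (x : Matrix n n k) (t : k) :
    unipotentBinom x t - 1 = (x - 1) *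
      ∑ j ∈ Finset.range (Fintype.card n - 1), (choosePoly k (j + 1)).eval t • (x - 1) ^ j := by
  rcases Nat.eq_zero_or_pos (Fintype.card n) with h0 | hpos
  · -- `n` empty: all matrices are `0 = 1`
    haveI : IsEmpty n := Fintype.card_eq_zero_iff.1 h0
    ext a _
    exact isEmptyElim a
  rw [unipotentBinom, ← Nat.sub_add_cancel hpos, Finset.sum_range_succ', pow_zero, choosePoly_zero,
    eval_one, one_smul, add_sub_cancel_right, Finset.mul_sum]
  simp only [Nat.sub_add_cancel hpos]
  refine Finset.sum_congr rfl fun j _ => ?_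
  rw [Matrix.mul_smul, pow_succ']

variable [CharZero k]

/-- **The binomial theorem: `xʲ = unipotentBinom x j` for `j ∈ ℕ`** and `x` unipotent
(`(1 + N)ʲ = ∑ᵢ C(j, i) Nⁱ`, the terms with `i ≥ n` vanishing). [folklore] -/
theorem unipotentBinom_natCast {x : Matrix n n k} (hx : IsNilpotent (x - 1)) (m : ℕ) :
    unipotentBinom x (m : k) = x ^ m := by
  set N : Matrix n n k := x - 1 with hN
  set D := Fintype.card n with hD
  have hND : N ^ D = 0 := pow_card_eq_zero_of_isNilpotent hx
  have hNpow : ∀ i, D ≤ i → N ^ i = 0 := fun i hi => by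
    rw [← Nat.sub_add_cancel hi, pow_add, hND, mul_zero]
  have hx1 : x = N + 1 := by rw [hN, sub_add_cancel]
  -- both sides as sums over a common large range
  have hbig : ∀ s : Finset ℕ, Finset.range D ⊆ s →
      unipotentBinom x (m : k) = ∑ i ∈ s, ((m.choose i : ℕ) : k) • N ^ i := by
    intro s hs
    rw [unipotentBinom]
    rw [← Finset.sum_subset hs]
    · refine Finset.sum_congr rfl fun i _ => ?_
      rw [eval_natCast_choosePoly]
    · intro i _ hi
      rw [Finset.mem_range, not_lt] at hi
      rw [hNpow i hi, smul_zero]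
  have hpow : x ^ m = ∑ i ∈ Finset.range (m + 1), ((m.choose i : ℕ) : k) • N ^ i := by
    rw [hx1, (Commute.one_right N).add_pow]
    refine Finset.sum_congr rfl fun i _ => ?_
    rw [one_pow, mul_one, ← nsmul_eq_mul', Nat.cast_smul_eq_nsmul]
  rw [hpow, hbig (Finset.range D ∪ Finset.range (m + 1)) Finset.subset_union_left,
    ← Finset.sum_subset (Finset.subset_union_right (s₁ := Finset.range D))]
  intro i _ hi
  rw [Finset.mem_range, not_lt] at hi
  rw [Nat.choose_eq_zero_of_lt hi, Nat.cast_zero, zero_smul]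

/-- `x⁰ = 1`. [folklore] -/
theorem unipotentBinom_zero {x : Matrix n n k} (hx : IsNilpotent (x - 1)) :
    unipotentBinom x 0 = 1 := by
  simpa using unipotentBinom_natCast hx 0

/-- `x¹ = x`. [folklore] -/
theorem unipotentBinom_one {x : Matrix n n k} (hx : IsNilpotent (x - 1)) :
    unipotentBinom x 1 = x := by
  simpa using unipotentBinom_natCast hx 1

/-- **The one-parameter group law `x^{a+b} = xᵃ xᵇ`** for a unipotent `x`, all `a, b ∈ k`: the
entries of both sides are polynomials in `(a, b)` which agree on `ℕ × ℕ` (`x^i x^j = x^{i+j}`),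
hence everywhere. [folklore] -/
theorem unipotentBinom_add {x : Matrix n n k} (hx : IsNilpotent (x - 1)) (a b : k) :
    unipotentBinom x (a + b) = unipotentBinom x a * unipotentBinom x b := by
  -- entry `(r, c)` of `x^{a+b}` resp. `xᵃ xᵇ` as a polynomial in `b` for fixed `a`
  let L : k → n → n → k[X] := fun a r c => (unipotentBinomEntryPoly x r c).comp (X + C a)
  let R : k → n → n → k[X] := fun a r c => ∑ m' : n, C (unipotentBinom x a r m') *
    unipotentBinomEntryPoly x m' c
  have hL : ∀ a b r c, unipotentBinom x (a + b) r c = (L a r c).eval b := by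
    intro a b r c
    simp only [L, eval_comp, eval_add, eval_X, eval_C, unipotentBinom_apply, add_comm b a]
  have hR : ∀ a b r c, (unipotentBinom x a * unipotentBinom x b) r c = (R a r c).eval b := by
    intro a b r c
    simp only [R, Matrix.mul_apply, eval_finsetSum, eval_mul, eval_C, unipotentBinom_apply]
  -- for `a ∈ ℕ` the two agree at all `b ∈ ℕ`, hence at all `b`
  have hnat : ∀ (i : ℕ) (b : k), unipotentBinom x ((i : k) + b) =
      unipotentBinom x (i : k) * unipotentBinom x b := by
    intro i b
    ext r c
    rw [hL, hR]
    congr 1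
    refine Polynomial.eq_of_forall_eval_natCast_eq fun j => ?_
    rw [← hL, ← hR, ← Nat.cast_add, unipotentBinom_natCast hx, unipotentBinom_natCast hx,
      unipotentBinom_natCast hx, pow_add]
  -- now fix `b` and vary `a`
  let L' : k → n → n → k[X] := fun b r c => (unipotentBinomEntryPoly x r c).comp (X + C b)
  let R' : k → n → n → k[X] := fun b r c => ∑ m' : n, unipotentBinomEntryPoly x r m' *
    C (unipotentBinom x b m' c)
  have hL' : ∀ a b r c, unipotentBinom x (a + b) r c = (L' b r c).eval a := by
    intro a b r c
    simp only [L', eval_comp, eval_add, eval_X, eval_C, unipotentBinom_apply]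
  have hR' : ∀ a b r c, (unipotentBinom x a * unipotentBinom x b) r c = (R' b r c).eval a := by
    intro a b r c
    simp only [R', Matrix.mul_apply, eval_finsetSum, eval_mul, eval_C, unipotentBinom_apply]
  ext r c
  rw [hL', hR']
  congr 1
  refine Polynomial.eq_of_forall_eval_natCast_eq fun i => ?_
  rw [← hL', ← hR', hnat]

/-- `xᵗ x⁻ᵗ = 1`. [folklore] -/
theorem unipotentBinom_mul_neg {x : Matrix n n k} (hx : IsNilpotent (x - 1)) (t : k) :
    unipotentBinom x t * unipotentBinom x (-t) = 1 := by
  rw [← unipotentBinom_add hx, add_neg_cancel, unipotentBinom_zero hx]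

/-- `x⁻ᵗ xᵗ = 1`. [folklore] -/
theorem unipotentBinom_neg_mul {x : Matrix n n k} (hx : IsNilpotent (x - 1)) (t : k) :
    unipotentBinom x (-t) * unipotentBinom x t = 1 := by
  rw [← unipotentBinom_add hx, neg_add_cancel, unipotentBinom_zero hx]

omit [CharZero k] in
/-- `xᵗ` is unipotent. [folklore] -/
theorem isNilpotent_unipotentBinom_sub_one {x : Matrix n n k} (hx : IsNilpotent (x - 1)) (t : k) :
    IsNilpotent (unipotentBinom x t - 1) := by
  rw [unipotentBinom_sub_one x t]
  have hc : Commute (x - 1) (∑ j ∈ Finset.range (Fintype.card n - 1),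
      (choosePoly k (j + 1)).eval t • (x - 1) ^ j) :=
    Commute.sum_right _ _ _ fun j _ => Commute.smul_right ((Commute.refl (x - 1)).pow_right j) _
  exact hc.isNilpotent_mul_right hx

end Series

/-! ### The homomorphism `𝔾ₐ → GL n k` and membership in algebraic subgroups -/

section Hom

variable [CharZero k]

/-- **The binomial one-parameter subgroup `t ↦ xᵗ` of `GL n k`** through a unipotent `x`
(inverse `x⁻ᵗ`). [folklore] -/
noncomputable def unipotentBinomHom {x : GL n k} (hx : IsUnipotentElt x) :
    Multiplicative k →* GL n k where
  toFun t :=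
    { val := unipotentBinom (x : Matrix n n k) (Multiplicative.toAdd t)
      inv := unipotentBinom (x : Matrix n n k) (-Multiplicative.toAdd t)
      val_inv := unipotentBinom_mul_neg hx _
      inv_val := unipotentBinom_neg_mul hx _ }
  map_one' := Units.ext (by simpa using unipotentBinom_zero hx)
  map_mul' a b := Units.ext (by
    change unipotentBinom (x : Matrix n n k) (Multiplicative.toAdd (a * b)) = _
    rw [toAdd_mul, unipotentBinom_add hx]
    rfl)

/-- The matrix of `unipotentBinomHom hx t` is `xᵗ`. [folklore] -/
@[simp] theorem coe_unipotentBinomHom {x : GL n k} (hx : IsUnipotentElt x) (t : k) :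
    ((unipotentBinomHom hx (Multiplicative.ofAdd t) : GL n k) : Matrix n n k) =
      unipotentBinom (x : Matrix n n k) t := rfl

/-- `x¹ = x`. [folklore] -/
theorem unipotentBinomHom_one {x : GL n k} (hx : IsUnipotentElt x) :
    unipotentBinomHom hx (Multiplicative.ofAdd (1 : k)) = x :=
  Units.ext (by rw [coe_unipotentBinomHom, unipotentBinom_one hx])

/-- `xʲ` for `j ∈ ℕ` is the `j`-th power. [folklore] -/
theorem unipotentBinomHom_natCast {x : GL n k} (hx : IsUnipotentElt x) (m : ℕ) :
    unipotentBinomHom hx (Multiplicative.ofAdd (m : k)) = x ^ m :=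
  Units.ext (by rw [coe_unipotentBinomHom, unipotentBinom_natCast hx, Units.val_pow_eq_pow_val])

/-- `(xᵗ)ᴹ = x^{M t}`. [folklore] -/
theorem unipotentBinomHom_pow {x : GL n k} (hx : IsUnipotentElt x) (t : k) (M : ℕ) :
    unipotentBinomHom hx (Multiplicative.ofAdd t) ^ M =
      unipotentBinomHom hx (Multiplicative.ofAdd ((M : k) * t)) := by
  rw [← map_pow, ← ofAdd_nsmul, nsmul_eq_mul]

/-- Each `xᵗ` is unipotent. [folklore] -/
theorem isUnipotentElt_unipotentBinomHom {x : GL n k} (hx : IsUnipotentElt x) (t : k) :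
    IsUnipotentElt (unipotentBinomHom hx (Multiplicative.ofAdd t)) :=
  isNilpotent_unipotentBinom_sub_one hx t

/-- The determinant of `xᵗ` is `1` (it is a polynomial in `t` whose product with its value at
`-t` is `1`, hence a constant, `= det x⁰ = 1`). [folklore] -/
theorem det_unipotentBinom {x : GL n k} (hx : IsUnipotentElt x) (t : k) :
    (unipotentBinom (x : Matrix n n k) t).det = 1 :=
  (isUnipotentElt_unipotentBinomHom hx t).det_eq_one

/-- **`t ↦ xᵗ` is an algebraic homomorphism `𝔾ₐ → GL n k`**: its coordinates (entries and
`det⁻¹ = 1`) are polynomials in `t`. [folklore] -/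
theorem isAlgebraicAddHom_unipotentBinomHom {x : GL n k} (hx : IsUnipotentElt x)
    {G : Subgroup (GL n k)} (hG : ∀ t, unipotentBinomHom hx t ∈ G) :
    IsAlgebraicAddHom (MonoidHom.codRestrict (unipotentBinomHom hx) G hG) := by
  refine ⟨Sum.elim (fun ab => unipotentBinomEntryPoly (x : Matrix n n k) ab.1 ab.2) (fun _ => 1),
    fun t c => ?_⟩
  rcases c with ⟨a, b⟩ | u
  · simp only [Sum.elim_inl, glCoordFun_inl]
    change unipotentBinom (x : Matrix n n k) (Multiplicative.toAdd (Multiplicative.ofAdd t)) a b = _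
    rw [toAdd_ofAdd, unipotentBinom_apply]
  · simp only [Sum.elim_inr, glCoordFun_inr, eval_one]
    change (Matrix.det (unipotentBinom (x : Matrix n n k)
      (Multiplicative.toAdd (Multiplicative.ofAdd t))))⁻¹ = 1
    rw [toAdd_ofAdd, det_unipotentBinom hx, inv_one]

/-- **`xᵗ` lies in every algebraic subgroup containing `x`** (characteristic `0`): for a defining
polynomial `p` of `H`, `t ↦ p(xᵗ)` is a polynomial in `t` vanishing at all `t ∈ ℕ`
(`xʲ ∈ H`), hence identically. So the `xᵗ` lie in the Zariski closure of the group generated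
by `x`. [folklore] -/
theorem unipotentBinomHom_mem {x : GL n k} (hx : IsUnipotentElt x) {H : Subgroup (GL n k)}
    (hH : IsAlgebraicSubgroup H) (hxH : x ∈ H) (t : k) :
    unipotentBinomHom hx (Multiplicative.ofAdd t) ∈ H := by
  obtain ⟨S, hS⟩ := hH
  rw [← SetLike.mem_coe, hS]
  intro p hp
  -- `p (xᵗ)` as a polynomial in `t`
  set Q : GLCoord n → k[X] :=
    Sum.elim (fun ab => unipotentBinomEntryPoly (x : Matrix n n k) ab.1 ab.2) (fun _ => 1) with hQ
  have hcoord : ∀ s : k, glCoordFun (unipotentBinomHom hx (Multiplicative.ofAdd s)) =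
      fun c => (Q c).eval s := by
    intro s
    funext c
    rcases c with ⟨a, b⟩ | u
    · simp only [hQ, Sum.elim_inl, glCoordFun_inl, coe_unipotentBinomHom, unipotentBinom_apply]
    · simp only [hQ, Sum.elim_inr, glCoordFun_inr, coe_unipotentBinomHom, det_unipotentBinom hx,
        inv_one, eval_one]
  have heval : ∀ s : k, MvPolynomial.eval (glCoordFun (unipotentBinomHom hx (Multiplicative.ofAdd s))) p
      = (MvPolynomial.aeval Q p : k[X]).eval s := by
    intro s
    rw [hcoord s]
    have h := congrArg (fun φ : MvPolynomial (GLCoord n) k →ₐ[k] k => φ p)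
      (MvPolynomial.algHom_ext (f := MvPolynomial.aeval (R := k) fun c => (Q c).eval s)
        (g := (Polynomial.aeval s).comp (MvPolynomial.aeval Q)) (fun c => by simp))
    simp only [AlgHom.comp_apply] at h
    rw [← MvPolynomial.aeval_eq_eval, h, Polynomial.coe_aeval_eq_eval]
  rw [heval]
  have hzero : (MvPolynomial.aeval Q p : k[X]) = 0 := by
    refine Polynomial.eq_zero_of_forall_eval_natCast_eq_zero fun m => ?_
    rw [← heval, unipotentBinomHom_natCast hx]
    have hm : x ^ m ∈ (H : Set (GL n k)) := H.pow_mem hxH m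
    rw [hS] at hm
    exact hm p hp
  rw [hzero, eval_zero]

/-- **Unipotent elements have `M`-th roots inside every algebraic subgroup containing them**
(characteristic `0`): for `x ∈ H` unipotent and `M ≥ 1` there is a unipotent `y ∈ H` with
`y ^ M = x`, namely `y = x^{1/M}`; moreover `y` is one of the `xᵗ`. This is the divisibility of
unipotent groups in characteristic zero behind Springer 6.3.5. [folklore] -/
theorem exists_pow_eq_of_isUnipotentElt {x : GL n k} (hx : IsUnipotentElt x)
    {H : Subgroup (GL n k)} (hH : IsAlgebraicSubgroup H) (hxH : x ∈ H) {M : ℕ} (hM : M ≠ 0) :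
    ∃ t : k, unipotentBinomHom hx (Multiplicative.ofAdd t) ∈ H ∧
      unipotentBinomHom hx (Multiplicative.ofAdd t) ^ M = x :=
  ⟨(M : k)⁻¹, unipotentBinomHom_mem hx hH hxH _, by
    rw [unipotentBinomHom_pow, mul_inv_cancel₀ (Nat.cast_ne_zero.2 hM), unipotentBinomHom_one]⟩

end Hom

end Literature.NumberTheory.Automorphic
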